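import Mathlib
import Summits.CriticalPhenomena.SAWScalingLimit.Theorems.SAWDefectDecoherenceDefectDecoherenceSsStarMassHarnackAux1
import Summits.CriticalPhenomena.SAWScalingLimit.Theorems.SAWDefectDecoherenceDefectDecoherenceSsStarMassHarnackAux2
import HarnessLib

/-!
# Star-mass Harnack from a return-loop bound (stub `stub_starMassHarnackOfLoopBound` =
`har_starMassHarnack_of_loopBound` of the line `sector-slaving`, crux `DefectDecoherence`,
stmt-CriticalPhenomena-8549)

Fix a simply connected `Λ`, an adjacent boundary root `a = s(u,w)` (`u ∉ Λ ∋ w`), a vertex `t ∈ Λ`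
all of whose neighbours lie in `Λ`, `t ≠ w`, and a neighbour `v` of `t`; write
`Z = Σ_{γ : a → s(v,t)} x_c^{ℓ(γ)}` for the `x_c`-mass at the mid-edge `{v,t}`, split by the last
vertex into the via-`t` part `P` and the via-`v` part `Q` (`Z = Q + P`), and
`A_v = Σ_{clean arrivals ω at t through v → t} x_c^{ℓ(ω)+1} ≤ x_c Q`.
The unconditional dart Harnack inequality of `…StarMassHarnackAux2` reads
`M(t) ≤ (2 + x_c⁻¹) Z + Σ_{s ∼ t, s ≠ v} R(t,s)` with `R(t,s)` the mass of the RETURN LOOPS at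
`(t,s)`, and `…StarMassHarnackAux1` bounds `R(t,s) ≤ N · Σ_{q ∼ t, q ≠ s} V(t,q;s)` under a bound
`N` on the `x_c`-mass of the walks of a simply connected domain between two boundary mid-edges at
a common exterior vertex, `V(t,q;s)` being the mass of the via-`t` walks at the dart `(t,q)`
avoiding `s`.  Here we close the estimate: for `s ≠ v`, the dart `q = v` contributes
`V(t,v;s) ≤ P` and the third dart `q ∉ {v,s}` contributes `V(t,q;s) ≤ A_v ≤ x_c Q ≤ Q` (a via-`t`
walk at `(t,q)` avoiding `s` arrived at `t` through `v`, by the via-`t` bijection `tip_sum_viaV`),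
so `Σ_{q ≠ s} V(t,q;s) ≤ Z`, `Σ_{s ≠ v} R(t,s) ≤ 2N Z` and
`M(t) ≤ (2 + x_c⁻¹ + 2N) Z` (`har_tip_harnack`).  Summing over the three neighbours `t` of a
`2`-deep `v` (`Σ_t Z(s(v,t)) = M(v)`) gives `NeighbourMassBound (2 + x_c⁻¹ + 2N)`
(`har_neighbourMassBound_of_loopBound`), and for `N ≤ 8` the constant `c = 2 + x_c⁻¹ + 2N`
satisfies `c · q < 3`, `q = slavingCoupling = 2 x_c sin(π/24)`: indeed
`c q = (2 + 4x_c + 4N x_c) sin(π/24) ≤ (2 + 36 · 0.55) · (3.15/24) < 2.87`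
(`x_c < 0.55` from `x_c² (2+√2) = 1`, `√2 > 1.4`; `sin x < x`, `π < 3.15`) —
`har_starMassHarnack_of_loopBound` = `stub_starMassHarnackOfLoopBound`.

Sources: H. Duminil-Copin, S. Smirnov, Ann. of Math. 175 (2012) (arXiv:1007.0575), §1–§2 (walks
between mid-edges, `x_c = 1/√(2+√2)`); the line card `Lines/sector-slaving.md`.
-/

noncomputable section

open scoped BigOperators ComplexConjugate Classical
open Literature.Probability.LatticeModels Literature.Probability.RandomPlanarGeometry.SAW
open Summit.CriticalPhenomena.SAWScalingLimit.Theorems.DefectDecoherence.TipMartingale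

namespace Summit.CriticalPhenomena.SAWScalingLimit.Theorems.DefectDecoherence.SectorSlaving

/-! ### Via-`t` walks avoiding a neighbour -/

section Avoid

variable {Λ : Finset HexVertex} {u w v t q s : HexVertex}

/-- **Via-`t` walks at the dart `(t,q)` avoiding `s` came through `v`.**  If `{v, s, q}` covers the
star of `t` and `q ≠ s`, the `x_c`-mass of the via-`t` walks `a → s(t,q)` (last vertex `t`) not
visiting `s` is at most the mass `A_v` of the clean arrivals at `t` through the dart `v → t`
(prolonged by `t`): by the via-`t` bijection such a walk is `ω ++ [t]` with `ω` a clean arrival at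
`t` through a dart `y ≠ q`, and `y = s` is excluded since `s` would be the last vertex of `ω`.
[folklore] -/
theorem har_viaT_avoiding_le_clean (hu : u ∉ Λ) (ht : t ∈ Λ) (hwt : w ≠ t) (hq : q ∈ star Λ t)
    (hcov : ∀ y ∈ star Λ t, y = v ∨ y = s ∨ y = q) :
    (∑ π : HexMidEdgeSAW Λ s(u, w) s(t, q),
        if π.verts.getLast? = some t ∧ s ∉ π.verts then xc ^ π.length else 0) ≤
      ∑ ω : HexMidEdgeSAW Λ s(u, w) s(v, t),
        if ω.verts.getLast? = some v ∧ t ∉ ω.verts then xc ^ (ω.length + 1) else 0 := by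
  have h := tip_sum_viaV hu ht hwt hq
    (fun l : List HexVertex => if s ∈ l then (0 : ℝ) else (xc : ℝ) ^ l.length)
  simp only [List.length_append, List.length_singleton] at h
  rw [Sym2.eq_swap (a := t) (b := q)]
  simp only [HexMidEdgeSAW.length]
  have e : (∑ π : HexMidEdgeSAW Λ s(u, w) s(q, t),
      (if π.verts.getLast? = some t ∧ s ∉ π.verts then xc ^ π.verts.length else (0 : ℝ))) =
      ∑ π : HexMidEdgeSAW Λ s(u, w) s(q, t),
        (if π.verts.getLast? = some t then
          (if s ∈ π.verts then (0 : ℝ) else xc ^ π.verts.length) else 0) := by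
    refine Finset.sum_congr rfl fun π _ => ?_
    by_cases h1 : π.verts.getLast? = some t
    · by_cases h2 : s ∈ π.verts
      · rw [if_neg (fun h' => h'.2 h2), if_pos h1, if_pos h2]
      · rw [if_pos ⟨h1, h2⟩, if_pos h1, if_neg h2]
    · rw [if_neg (fun h' => h1 h'.1), if_neg h1]
  rw [e, h]
  -- the clean arrival mass through `v`
  set A' : ℝ := ∑ ω : HexMidEdgeSAW Λ s(u, w) s(v, t),
    (if ω.verts.getLast? = some v ∧ t ∉ ω.verts then xc ^ (ω.verts.length + 1) else 0) with hA'
  have hA0 : 0 ≤ A' := Finset.sum_nonneg fun ω _ => by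
    split_ifs
    · exact pow_nonneg xc_pos.le _
    · exact le_rfl
  refine le_trans (b := ∑ y ∈ star Λ t, (if y = v then A' else 0))
    (Finset.sum_le_sum fun y hy => ?_) ?_
  swap
  · rw [Finset.sum_ite_eq']
    split_ifs
    · exact le_rfl
    · exact hA0
  rcases hcov y hy with rfl | rfl | rfl
  · -- through `v`: termwise
    rw [if_pos rfl]
    refine Finset.sum_le_sum fun ω _ => ?_
    split_ifs <;> first | exact le_rfl | exact pow_nonneg xc_pos.le _
  · -- through `s`: every term vanishes (`s` is the last vertex of `ω`)
    refine (Finset.sum_eq_zero fun ω _ => ?_).trans_le ?_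
    · split_ifs with h1 h2 h3 <;>
        first | rfl | exact absurd (List.mem_append_left _ (List.mem_of_getLast? h1.1)) h3
    · split_ifs <;> first | exact le_rfl | exact hA0
  · -- through `q`: excluded by the bijection
    refine (Finset.sum_eq_zero fun ω _ => ?_).trans_le ?_
    · split_ifs with h1 h2 <;> first | rfl | exact absurd rfl h2
    · split_ifs <;> first | exact le_rfl | exact hA0

/-- The via-`t` walks at the dart `(t,v)` avoiding `s` are among the via-`t` walks at the mid-edge
`{v,t}`. [folklore] -/
theorem har_viaT_avoiding_le_viaT (s : HexVertex) :
    (∑ π : HexMidEdgeSAW Λ s(u, w) s(t, v),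
        if π.verts.getLast? = some t ∧ s ∉ π.verts then xc ^ π.length else 0) ≤
      ∑ γ : HexMidEdgeSAW Λ s(u, w) s(v, t),
        (if γ.verts.getLast? = some t then xc ^ γ.length else 0) := by
  rw [Sym2.eq_swap (a := t) (b := v)]
  refine Finset.sum_le_sum fun γ _ => ?_
  by_cases h1 : γ.verts.getLast? = some t ∧ s ∉ γ.verts
  · rw [if_pos h1, if_pos h1.1]
  · rw [if_neg h1]
    split_ifs
    · exact pow_nonneg xc_pos.le _
    · exact le_rfl

end Avoid

/-! ### The dart Harnack inequality at a tip, closed by the loop bound -/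

/-- **Registered helper `har_tip_harnack` (dart Harnack inequality at a tip).**  Under a bound
`N ≥ 0` on the `x_c`-mass of the walks of every simply connected domain between two boundary
mid-edges at a common exterior vertex: for a simply connected `Λ`, an adjacent boundary root
`s(u,w)` (`u ∉ Λ`), `t ∈ Λ` with `t ≠ w`, all neighbours of `t` in `Λ`, and `v ∼ t`,
`M(t) ≤ (2 + x_c⁻¹ + 2N) · Z(s(v,t))`. [folklore] -/
theorem har_tip_harnack : ∀ (Λ : Finset HexVertex) (u w v t : HexVertex) (N : ℝ),
    hexDomainSimplyConnected Λ → hexGraph.Adj u w → u ∉ Λ → t ∈ Λ → w ≠ t → hexGraph.Adj t v →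
    (∀ y : HexVertex, hexGraph.Adj t y → y ∈ Λ) → 0 ≤ N → (∀ (Λ' : Finset HexVertex),
    hexDomainSimplyConnected Λ' → ∀ (t q s : HexVertex), t ∉ Λ' → q ∈ Λ' → s ∈ Λ' →
    hexGraph.Adj t q → hexGraph.Adj t s → q ≠ s →
    (∑ τ : HexMidEdgeSAW Λ' s(t, q) s(s, t), xc ^ τ.length) ≤ N) →
    mass Λ u w t ≤ (2 + xc⁻¹ + 2 * N) * ∑ γ : HexMidEdgeSAW Λ s(u, w) s(v, t), xc ^ γ.length := by
  intro Λ u w v t N hΛ huw hu ht hwt htv hΛt hN0 hN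
  -- the three darts at `t`
  obtain ⟨n₁, n₂, n₃⟩ := tip_rot3_ne htv
  have hstar := tip_star_eq htv hΛt
  set s₁ := rot3 t v with hs₁
  set s₂ := rot3 t (rot3 t v) with hs₂
  have hvΛ : v ∈ Λ := hΛt v htv
  have h1 : s₁ ∈ star Λ t := by rw [hstar]; simp
  have h2 : s₂ ∈ star Λ t := by rw [hstar]; simp
  have hcov : ∀ y ∈ star Λ t, y = v ∨ y = s₁ ∨ y = s₂ := fun y hy => by
    simpa [hstar] using hy
  -- the quantities at the mid-edge `{v,t}` and at the darts of `t`
  set Z : ℝ := ∑ γ : HexMidEdgeSAW Λ s(u, w) s(v, t), xc ^ γ.length with hZ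
  set P : ℝ := ∑ γ : HexMidEdgeSAW Λ s(u, w) s(v, t),
    (if γ.verts.getLast? = some t then xc ^ γ.length else 0) with hP
  set Q : ℝ := ∑ γ : HexMidEdgeSAW Λ s(u, w) s(v, t),
    (if γ.verts.getLast? = some v then xc ^ γ.length else 0) with hQ
  set A : ℝ := ∑ ω : HexMidEdgeSAW Λ s(u, w) s(v, t),
    (if ω.verts.getLast? = some v ∧ t ∉ ω.verts then xc ^ (ω.length + 1) else 0) with hA
  set V : HexVertex → HexVertex → ℝ := fun q s => ∑ π : HexMidEdgeSAW Λ s(u, w) s(t, q),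
    (if π.verts.getLast? = some t ∧ s ∉ π.verts then xc ^ π.length else 0) with hV
  set R : HexVertex → ℝ := fun s => ∑ γ : HexMidEdgeSAW Λ s(u, w) s(s, t),
    (if γ.verts.getLast? = some s ∧ t ∈ γ.verts then xc ^ γ.length else 0) with hR
  have hx0 : 0 < xc := xc_pos
  have hx1 : xc < 1 := hexCriticalFugacity_pos_lt_one.2
  have hQ0 : 0 ≤ Q := Finset.sum_nonneg fun γ _ => by
    split_ifs
    · exact pow_nonneg hx0.le _
    · exact le_rfl
  -- last-vertex split, clean arrivals through `v`
  have hsplit : Z = Q + P := tip_sum_split_last hu ht hvΛ htv.ne.symm _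
  have hAQ : A ≤ xc * Q := har_clean_le_viaY v
  have hxQ : xc * Q ≤ Q := mul_le_of_le_one_left hQ0 hx1.le
  -- the via-`t` walks avoiding a neighbour
  have eP : ∀ s, V v s ≤ P := fun s => har_viaT_avoiding_le_viaT s
  have e12 : V s₂ s₁ ≤ A := har_viaT_avoiding_le_clean hu ht hwt h2 hcov
  have e21 : V s₁ s₂ ≤ A :=
    har_viaT_avoiding_le_clean hu ht hwt h1 fun y hy => (hcov y hy).imp_right Or.symm
  have hd1 : ∑ q ∈ star Λ t, (if q = s₁ then 0 else V q s₁) ≤ Z := by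
    rw [hstar, har_sum_three n₁ n₂ n₃, if_neg n₁, if_pos rfl, if_neg n₃.symm, add_zero]
    linarith [eP s₁]
  have hd2 : ∑ q ∈ star Λ t, (if q = s₂ then 0 else V q s₂) ≤ Z := by
    rw [hstar, har_sum_three n₁ n₂ n₃, if_neg n₂, if_neg n₃, if_pos rfl, add_zero]
    linarith [eP s₂]
  -- the return loops
  have hR1 : R s₁ ≤ N * ∑ q ∈ star Λ t, (if q = s₁ then 0 else V q s₁) :=
    har_returnLoop_le hΛ huw hu ht hwt h1 hN0 hN
  have hR2 : R s₂ ≤ N * ∑ q ∈ star Λ t, (if q = s₂ then 0 else V q s₂) :=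
    har_returnLoop_le hΛ huw hu ht hwt h2 hN0 hN
  have hRsum : ∑ s ∈ star Λ t, (if s = v then 0 else R s) ≤ 2 * N * Z := by
    rw [hstar, har_sum_three n₁ n₂ n₃, if_pos rfl, if_neg n₁.symm, if_neg n₂.symm, zero_add]
    have m1 := mul_le_mul_of_nonneg_left hd1 hN0
    have m2 := mul_le_mul_of_nonneg_left hd2 hN0
    linarith
  -- assemble with the unconditional dart Harnack inequality
  have hmain : ∑ s ∈ star Λ t, ∑ γ : HexMidEdgeSAW Λ s(u, w) s(s, t), xc ^ γ.length ≤
      (2 + xc⁻¹) * Z + ∑ s ∈ star Λ t, (if s = v then 0 else R s) :=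
    har_tip_le_add_returnLoops hu ht hwt htv hΛt
  rw [har_mass_eq_sum_in]
  calc ∑ s ∈ star Λ t, ∑ γ : HexMidEdgeSAW Λ s(u, w) s(s, t), xc ^ γ.length
      ≤ (2 + xc⁻¹) * Z + ∑ s ∈ star Λ t, (if s = v then 0 else R s) := hmain
    _ ≤ (2 + xc⁻¹) * Z + 2 * N * Z := by linarith
    _ = (2 + xc⁻¹ + 2 * N) * Z := by ring

/-- **Registered helper `har_neighbourMassBound_of_loopBound`.**  Under the loop bound `N ≥ 0`,
the neighbour star masses at a `2`-deep vertex satisfy `Σ_{t ∼ v} M(t) ≤ (2 + x_c⁻¹ + 2N) M(v)`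
(sum `har_tip_harnack` over the three neighbours `t` of `v`; `Σ_t Z(s(v,t)) = M(v)`). [folklore] -/
theorem har_neighbourMassBound_of_loopBound : ∀ N : ℝ, 0 ≤ N → (∀ (Λ' : Finset HexVertex),
    hexDomainSimplyConnected Λ' → ∀ (t q s : HexVertex), t ∉ Λ' → q ∈ Λ' → s ∈ Λ' →
    hexGraph.Adj t q → hexGraph.Adj t s → q ≠ s →
    (∑ τ : HexMidEdgeSAW Λ' s(t, q) s(s, t), xc ^ τ.length) ≤ N) →
    NeighbourMassBound (2 + xc⁻¹ + 2 * N) := by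
  intro N hN0 hN Λ hΛ u w huw hu _ v hdeep
  have hM : mass Λ u w v = ∑ t ∈ star Λ v, ∑ γ : HexMidEdgeSAW Λ s(u, w) s(v, t), xc ^ γ.length :=
    Finset.sum_congr rfl fun t _ => har_norm_obs _ _ _
  rw [hM, Finset.mul_sum]
  refine Finset.sum_le_sum fun t ht => ?_
  obtain ⟨htΛ, hvt⟩ := tip_mem_star.1 ht
  exact har_tip_harnack Λ u w v t N hΛ huw hu htΛ (har_root_ne hdeep huw hu hvt) hvt.symm
    (har_nbrs_mem hdeep hvt) hN0 hN

/-! ### The numerical threshold `c · q < 3` -/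

/-- `x_c = 1/√(2+√2) < 0.55` (from `x_c² (2 + √2) = 1` and `√2 > 1.4`). [folklore] -/
theorem har_xc_lt : xc < 11 / 20 := by
  have h : xc ^ 2 * (2 + Real.sqrt 2) = 1 := hexCriticalFugacity_sq
  have hs : (1.4 : ℝ) < Real.sqrt 2 := (Real.lt_sqrt (by norm_num)).2 (by norm_num)
  have h1 : 0 ≤ xc ^ 2 * (Real.sqrt 2 - 1.4) := mul_nonneg (sq_nonneg _) (by linarith)
  have hx2 : xc ^ 2 < (11 / 20) ^ 2 := by nlinarith
  exact lt_of_pow_lt_pow_left₀ 2 (by norm_num) hx2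

/-- `sin(π/24) < 3.15/24 = 21/160` (`sin x < x`, `π < 3.15`). [folklore] -/
theorem har_sin_pi_div_lt : Real.sin (Real.pi / 24) < 21 / 160 := by
  have h := Real.sin_lt (show 0 < Real.pi / 24 by positivity)
  linarith [Real.pi_lt_d2]

/-- **The threshold.**  For `N ≤ 8` the Harnack constant `c = 2 + x_c⁻¹ + 2N` satisfies
`c · q < 3`, `q = slavingCoupling = 2 x_c sin(π/24)`:
`c q = (2 + 4x_c + 4N x_c) sin(π/24) ≤ 21.8 · 21/160 < 2.87`. [folklore] -/
theorem har_coupling_lt_three {N : ℝ} (hN8 : N ≤ 8) :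
    (2 + xc⁻¹ + 2 * N) * slavingCoupling < 3 := by
  unfold slavingCoupling
  have hx0 : 0 < xc := xc_pos
  have hx : xc < 11 / 20 := har_xc_lt
  have hs0 : 0 ≤ Real.sin (Real.pi / 24) :=
    Real.sin_nonneg_of_nonneg_of_le_pi (by positivity) (by linarith [Real.pi_pos])
  have hs : Real.sin (Real.pi / 24) < 21 / 160 := har_sin_pi_div_lt
  have hinv : xc⁻¹ * xc = 1 := inv_mul_cancel₀ hx0.ne'
  have e : (2 + xc⁻¹ + 2 * N) * (2 * xc * Real.sin (Real.pi / 24)) =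
      (4 * xc + 2 * (xc⁻¹ * xc) + 4 * N * xc) * Real.sin (Real.pi / 24) := by ring
  rw [e, hinv]
  have hNx : N * xc ≤ 8 * xc := mul_le_mul_of_nonneg_right hN8 hx0.le
  have hF : 4 * xc + 2 * 1 + 4 * N * xc ≤ 2 + 36 * (11 / 20) := by nlinarith
  calc (4 * xc + 2 * 1 + 4 * N * xc) * Real.sin (Real.pi / 24)
      ≤ (2 + 36 * (11 / 20)) * Real.sin (Real.pi / 24) := mul_le_mul_of_nonneg_right hF hs0
    _ ≤ (2 + 36 * (11 / 20)) * (21 / 160) := by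
        exact mul_le_mul_of_nonneg_left hs.le (by norm_num)
    _ < 3 := by norm_num

/-! ### The registered stub -/

/-- **Registered helper `har_starMassHarnack_of_loopBound` (= the stub).**  A return-loop bound
`N ∈ [0, 8]` closes the neighbour star-mass Harnack inequality with a constant `c` satisfying
`c · q < 3` (`c = 2 + x_c⁻¹ + 2N`). [folklore] -/
theorem har_starMassHarnack_of_loopBound : ∀ N : ℝ, 0 ≤ N → N ≤ 8 → (∀ (Λ' : Finset HexVertex),
    hexDomainSimplyConnected Λ' → ∀ (t q s : HexVertex), t ∉ Λ' → q ∈ Λ' → s ∈ Λ' →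
    hexGraph.Adj t q → hexGraph.Adj t s → q ≠ s →
    (∑ τ : HexMidEdgeSAW Λ' s(t, q) s(s, t), xc ^ τ.length) ≤ N) →
    ∃ c : ℝ, c * slavingCoupling < 3 ∧ NeighbourMassBound c :=
  fun N hN0 hN8 hN =>
    ⟨2 + xc⁻¹ + 2 * N, har_coupling_lt_three hN8, har_neighbourMassBound_of_loopBound N hN0 hN⟩

/-- **Stub `stub_starMassHarnackOfLoopBound` of the line `sector-slaving`** (reshape c2; the
elementary closure of `StarMassHarnack` from the return-loop bound): for every `N ∈ [0, 8]`
bounding the `x_c`-mass of the walks of a simply connected domain between two boundary mid-edges at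
a common exterior vertex, `∃ c, c · q < 3 ∧ NeighbourMassBound c`. [folklore] -/
theorem stub_starMassHarnackOfLoopBound : ∀ N : ℝ, 0 ≤ N → N ≤ 8 → (∀ (Λ' : Finset HexVertex),
    hexDomainSimplyConnected Λ' → ∀ (t q s : HexVertex), t ∉ Λ' → q ∈ Λ' → s ∈ Λ' →
    hexGraph.Adj t q → hexGraph.Adj t s → q ≠ s →
    (∑ τ : HexMidEdgeSAW Λ' s(t, q) s(s, t), xc ^ τ.length) ≤ N) →
    ∃ c : ℝ, c * slavingCoupling < 3 ∧ NeighbourMassBound c :=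
  har_starMassHarnack_of_loopBound

end Summit.CriticalPhenomena.SAWScalingLimit.Theorems.DefectDecoherence.SectorSlaving

end
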